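import Summits.HodgeConjecture.HodgeConjecture.Theorems.MarkmanPartnerTransportPartnerTransportIncidence
import Summits.HodgeConjecture.HodgeConjecture.Theorems.MarkmanPartnerTransportPartnerTransportInverse

/-!
# Route MarkmanPartnerTransport · supports `PartnerTransport` / `IsometrySpannedThird` —
# transcendental classes along the marked Hilbert square: `T(S^{[2]}) = [θ]_* T(S)`, and rational Hodge
# isometries preserve `T`

* `k3HilbertForm_delta_right` — `q(v, (0,1)) = −2 v_δ`;
* `exists_incidence_eq_of_bbfTransc` — **`T(H) = i(T(S))`**: a `q`-transcendental class `w` of the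
  fourfold `H` marked with period `(x,0)` (with Beauville's algebraic incidence `θ`, `φ_H([θ]_* a) = (η a, 0)`)
  is `[θ]_* t` for the cup-transcendental class `t = π w` of `S` (`w ⊥ δ` kills the `δ`-coordinate;
  `[θ]_* N¹(S) ⊆ N¹(H)` makes `π w` transcendental);
* `bbfTransc_map_of_markedHodgeIsometry` — a bijective marked rational Hodge isometry `H²(H) ⥲ H²(X)`
  carries `q`-transcendental classes to `q`-transcendental classes (its inverse respects `N¹`).

No definition, no sorry, no named fact beyond the hypothesis `Voisin2003_cupProduct_algebraicClasses`.
Prover seat hodge-nonav-19652-p1 (gen 6), `--supports stmt-HodgeConjecture-19650`.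

References: A. Beauville, J. Differential Geom. 18 (1983) §6 Prop. 6 and Remarque, §9 Lemme 1;
D. Huybrechts, *Lectures on K3 Surfaces* Ch. 3 Def. 2.5, Lemma 3.1; C. Voisin, *Hodge Theory I* Thm. 11.30.
-/

noncomputable section

set_option linter.dupNamespace false

open scoped Matrix
open Module CategoryTheory MonoidalCategory
open Literature.AlgebraicTopology.SingularHomology Literature.Geometry.Kaehler
open Literature.AlgebraicGeometry Literature.AlgebraicGeometry.Motives Literature.AlgebraicGeometry.HodgeTheory
open Literature.AlgebraicGeometry.Hyperkaehler Literature.AlgebraicGeometry.Surfaces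
open Summit.HodgeConjecture.HodgeConjecture.Theorems.NikulinTwinTransport
open Summit.HodgeConjecture.HodgeConjecture.Theorems.MarkmanPartnerTransport.BBFPositivity

namespace Summit.HodgeConjecture.HodgeConjecture.Theorems.MarkmanPartnerTransport.PartnerLattice

/-- `MarkedK3Sq[X, φ, P, z]`: VERBATIM the `let MarkedK3Sq := …` binder of the route declarations of
MarkmanPartnerTransport (clauses (m1)–(m6)). Local notation only. -/
local notation3 (prettyPrint := false) "MarkedK3Sq[" X ", " φ ", " P ", " z "]" =>
  (((IsIntegralClass P ∧ ∀ Q : complexBetti X (2 * 4), IsIntegralClass Q → ∃ n : ℤ, Q = n • P) ∧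
    (∀ c : complexBetti X 2, IsIntegralClass c ↔ ∃ v : K3HilbertIndex → ℤ, φ c = fun i => (v i : ℂ)) ∧
    (∀ a : complexBetti X 2, cupPowTwo a 4 = ((3 : ℂ) * (k3HilbertForm 2 (φ a) (φ a)) ^ 2) • P) ∧
    (IsOfHodgeType 4 X 2 2 0 (LinearEquiv.symm φ z) ∧
      ∀ τ : complexBetti X 2, IsOfHodgeType 4 X 2 2 0 τ → ∃ t : ℂ, τ = t • LinearEquiv.symm φ z) ∧
    (∀ c : complexBetti X 2, IsOfHodgeType 4 X 2 1 1 c ↔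
      (k3HilbertForm 2 (φ c) z = 0 ∧ k3HilbertForm 2 (φ c) (star z) = 0)) ∧
    (k3HilbertForm 2 z z = 0 ∧ 0 < (k3HilbertForm 2 (star z) z).re)))

/-- `q(v, (0, 1)) = −2 · v_δ` (`δ² = −2`, `δ ⟂ Λ_{K3}`). [cite: Beauville1983, §9 Lemme 1 and Rem. 1] -/
theorem k3HilbertForm_delta_right (v : K3HilbertIndex → ℂ) :
    k3HilbertForm 2 v (Sum.elim 0 1) = -2 * v (Sum.inr ()) := by
  have hv : v = Sum.elim (fun k => v (Sum.inl k)) (fun u => v (Sum.inr u)) := by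
    funext i; rcases i with k | u <;> rfl
  conv_lhs => rw [hv]
  simp [k3HilbertForm, Fintype.sum_sum_type, k3HilbertGram_inl_inr, k3HilbertGram_two_inr_inr]
  ring

variable {X S H : SchemeOver ℂ} {φ : complexBetti X 2 ≃ₗ[ℂ] (K3HilbertIndex → ℂ)} {P : complexBetti X (2 * 4)}
  {z : K3HilbertIndex → ℂ} {η : complexBetti S (2 * 1) ≃ₗ[ℂ] (K3Index → ℂ)} {p : complexBetti S (2 * 2)}
  {x : K3Index → ℂ} {φH : complexBetti H 2 ≃ₗ[ℂ] (K3HilbertIndex → ℂ)} {PH : complexBetti H (2 * 4)}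

/-- **`T(H) = [θ]_* T(S)`**: a `q`-transcendental class `w` of `H` equals `[θ]_* (π w)` with `π w`
cup-transcendental on `S` (module docstring). [cite: Beauville1983, §6 Prop. 6 and Remarque, §9 Lemme 1]
[cite: Huybrechts2016K3, Ch. 3 Def. 2.5] -/
theorem exists_incidence_eq_of_bbfTransc
    (hcup : Voisin2003_cupProduct_algebraicClasses) {μ : OrientationFamily} (hμ : μ.HasPoincareDuality)
    (hS : IsK3Surface S)
    (hcupS : ∀ a b : complexBetti S (2 * 1),
      cupProduct (rfl : 2 * 1 + 2 * 1 = 2 * 2) a b = k3Form (η a) (η b) • p)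
    (hH : IsSmoothProjective 4 H) (hMH : MarkedK3Sq[H, φH, PH, Sum.elim x 0])
    {θ : complexBetti (H ⊗ S) (2 * 2)} (hθ : θ ∈ algebraicClasses (H ⊗ S) 2)
    (hi : ∀ a : complexBetti S (2 * 1),
      φH (corrAction μ hH (IsK3Surface.isSmoothProjective hS) (rfl : 2 * 1 + 2 * 2 = 2 + 2 * 2) θ a) =
        Sum.elim (η a) 0)
    {w : complexBetti H 2} (hw : ∀ d ∈ algebraicClasses H 1, k3HilbertForm 2 (φH w) (φH d) = 0) :
    (∀ d ∈ algebraicClasses S 1,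
      cupProduct (rfl : 2 * 1 + 2 * 1 = 2 * 2) (η.symm (fun k => φH w (Sum.inl k))) d = 0) ∧
      corrAction μ hH (IsK3Surface.isSmoothProjective hS) (rfl : 2 * 1 + 2 * 2 = 2 + 2 * 2) θ
        (η.symm (fun k => φH w (Sum.inl k))) = w := by
  have hS2 : IsSmoothProjective 2 S := IsK3Surface.isSmoothProjective hS
  -- the `δ`-coordinate of `w` vanishes
  have hδ : φH w (Sum.inr ()) = 0 := by
    have h := hw _ (delta_mem_algebraicClasses hH hMH)
    rw [LinearEquiv.apply_symm_apply, k3HilbertForm_delta_right] at h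
    have h2 : (-2 : ℂ) ≠ 0 := by norm_num
    exact (mul_eq_zero.1 h).resolve_left h2
  have hwsum : φH w = Sum.elim (fun k => φH w (Sum.inl k)) 0 := by
    funext i
    rcases i with k | u
    · rfl
    · obtain rfl : u = () := rfl
      simpa using hδ
  refine ⟨fun d hd => ?_, ?_⟩
  · have hiN : corrAction μ hH hS2 (rfl : 2 * 1 + 2 * 2 = 2 + 2 * 2) θ d ∈ algebraicClasses H 1 :=
      corrAction_mem_algebraicClasses_of_cupProductFact hcup hμ hH hS2 (q := 1) rfl (by norm_num) hθ hd
    have h0 := hw _ hiN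
    rw [hi d, hwsum, k3HilbertForm_inl] at h0
    rw [hcupS, LinearEquiv.apply_symm_apply, h0, zero_smul]
  · apply φH.injective
    rw [hi, LinearEquiv.apply_symm_apply, ← hwsum]

/-- **A bijective marked rational Hodge isometry carries `q`-transcendental classes of `H` to
`q`-transcendental classes of `X`** (its inverse sends `N¹(X)` into `N¹(H)`).
[cite: Huybrechts2016K3, Ch. 3 Def. 2.5 and Lemma 3.1] [cite: VoisinHodgeI2002, Thm. 11.30] -/
theorem bbfTransc_map_of_markedHodgeIsometry (hH : IsSmoothProjective 4 H) (hX : IsSmoothProjective 4 X)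
    (e : complexBetti H 2 ≃ₗ[ℂ] complexBetti X 2)
    (hsrat : ∀ c, IsRationalClass c → IsRationalClass (e.symm c))
    (hs11 : ∀ c, IsOfHodgeType 4 X 2 1 1 c → IsOfHodgeType 4 H 2 1 1 (e.symm c))
    (heq : ∀ a b, k3HilbertForm 2 (φ (e a)) (φ (e b)) = k3HilbertForm 2 (φH a) (φH b))
    {w : complexBetti H 2} (hw : ∀ d ∈ algebraicClasses H 1, k3HilbertForm 2 (φH w) (φH d) = 0) :
    ∀ d ∈ algebraicClasses X 1, k3HilbertForm 2 (φ (e w)) (φ d) = 0 := by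
  intro d hd
  have h1 : k3HilbertForm 2 (φ (e w)) (φ d) = k3HilbertForm 2 (φ (e w)) (φ (e (e.symm d))) := by
    rw [LinearEquiv.apply_symm_apply]
  rw [h1, heq]
  exact hw _ (map_mem_algebraicClasses_of_isRationalClass_of_oneOne hX hH
    (e.symm : complexBetti X 2 →ₗ[ℂ] complexBetti H 2) hsrat hs11 hd)

/-- The same for an automorphism of one marked fourfold read backwards: if `e` (rational, `(1,1)`-preserving)
maps `N¹(X)` into itself, then `e⁻¹` carries `q`-transcendental classes to `q`-transcendental classes
(`e⁻¹` isometric). [cite: Huybrechts2016K3, Ch. 3 Def. 2.5 and Lemma 3.1] -/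
theorem bbfTransc_symm_of_markedHodgeIsometry (hX : IsSmoothProjective 4 X)
    (e : complexBetti X 2 ≃ₗ[ℂ] complexBetti X 2)
    (herat : ∀ c, IsRationalClass c → IsRationalClass (e c))
    (he11 : ∀ c, IsOfHodgeType 4 X 2 1 1 c → IsOfHodgeType 4 X 2 1 1 (e c))
    (hseq : ∀ a b, k3HilbertForm 2 (φ (e.symm a)) (φ (e.symm b)) = k3HilbertForm 2 (φ a) (φ b))
    {w : complexBetti X 2} (hw : ∀ d ∈ algebraicClasses X 1, k3HilbertForm 2 (φ w) (φ d) = 0) :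
    ∀ d ∈ algebraicClasses X 1, k3HilbertForm 2 (φ (e.symm w)) (φ d) = 0 := by
  intro d hd
  have h1 : k3HilbertForm 2 (φ (e.symm w)) (φ d) = k3HilbertForm 2 (φ (e.symm w)) (φ (e.symm (e d))) := by
    rw [LinearEquiv.symm_apply_apply]
  rw [h1, hseq]
  exact hw _ (map_mem_algebraicClasses_of_isRationalClass_of_oneOne hX hX
    (e : complexBetti X 2 →ₗ[ℂ] complexBetti X 2) herat he11 hd)

end Summit.HodgeConjecture.HodgeConjecture.Theorems.MarkmanPartnerTransport.PartnerLattice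

end
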